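import Summits.BirchSwinnertonDyer.BirchSwinnertonDyer.Theorems.SignedBaseChangeAnticyclotomicEisensteinDivisibilityAdmdefChebSplitTarget
import Summits.BirchSwinnertonDyer.BirchSwinnertonDyer.Theorems.SignedBaseChangeAnticyclotomicEisensteinDivisibilityAdmdefChebSplit
import Summits.BirchSwinnertonDyer.BirchSwinnertonDyer.Theorems.AdditiveKolyvaginRoadVisibleCoreBricks
import Literature.NumberTheory.Automorphic.BrandtGrossPoints
import Literature.NumberTheory.Automorphic.BrandtEigenLine
import Literature.NumberTheory.EllipticCurves.ZhangLevelRaisedKolyvaginData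
import HarnessLib

/-!
# Line `admdef`, cell β: W. ZHANG'S SELMER-KILLING WALK TO AN ODD ZERO VERTEX IN KERNEL (the (P2) half of [NV″]), and
# [NV″]'s consequent from (Par) + (Anch)
# (crux `AnticyclotomicEisensteinDivisibility`, stmt-BirchSwinnertonDyer-20727; LEAD seat bsd-line-sbc-p1 gen 17,
# `--supports stmt-BirchSwinnertonDyer-20727`)

WHY THIS FILE.  The v6 research stubs `stub_definiteNV_twoMult/leOneMult` of `Cruxes/AnticyclotomicEisensteinDivisibility/Lines/admdef.lean`
([NV″]: an ODD Zhang-admissible level `s`, a Brandt set-up of type `(N, ∏ s)`, a Gross point and a mod-`p` Hecke eigenvector for `a_•(E)` with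
NON-ZERO toric period) were booked by the LEAD memo (gen 16, §3/§6) as (P2) «run W. Zhang's Thm 9.1 induction to a definite vertex» + (P3)
«the anchor at that vertex».  Following the crux idea «selwalk» (bsd-idea-5 g22; `Ideas/selwalk.md`, sketch `Lines/selwalk_sketch.lean`,
whose §4–§5 this file lands with credit), (P2) is now KERNEL on cell β:

* §1 `localCheb_of_admQ_of_split` — (Cheb) on β in the binder shape of the AKR reduction `AdditiveKoly.selQP_rankLowering_of_localGlobal`:
  every non-zero class of `Sel_n^μ ⊂ H¹(K, E[p])` is detected at the place of a NEW Bertolini–Darmon admissible prime — from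
  `…AdmdefChebSplit.exists_admissible_loc_ne_zero_of_target` + `…AdmdefChebSplitTarget.exists_admissible_target_of_split`
  (frame: `p ≥ 5`, `ρ̄_{E,p}` onto, `K` imaginary quadratic, `N_E` Heegner, `p` SPLIT in `K`, `c ≠ 1`);
* §2 `selQP_rankLowering_of_split` ((A1): W. Zhang Prop 5.4 from (Cheb) + the four kernel local inputs `localEquiv/Line/Trans_of_admQ`,
  `hiso_of_admQ`), `exists_zero_vertex_above_of_split` (descent: above every level `n` a level `n' ⊇ n` with `Sel_{n'}^± = 0` and
  `#n' = #n + dim Sel_n⁺ + dim Sel_n⁻` — the proof of `AdditiveKoly.exists_zero_vertex_above` verbatim), `exists_oddZeroVertex_of_split`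
  ((P2): an odd bottom dimension gives an ODD-cardinality admissible level with `Sel^± = 0`);
* §3 `definiteToricNV_of_anchor_of_split` — **the consequent of [NV″] VERBATIM from (Par) «`dim Sel_p(E/K)⁺ + dim Sel_p(E/K)⁻` odd» and
  (Anch) = (P3) «every odd ZERO vertex carries the Brandt data with non-zero toric period»**, on cell β's frame.

So after this file [NV″] on β = (Par) [PRINT: Dokchitser–Dokchitser 2010 §4.6 step (4) = tree named fact
`dokchitser_selmerCorank_baseChange_mod_two_eq` («`rk_p(E/K)` odd» for `K` imaginary quadratic Heegner, `p` odd) + Cassels–Tate evenness of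
`dim (Ш/div)[p]` + the Kummer dictionary `Sel_p(E[p]/K) = Sel_{p^∞}(E/K)[p]` at `E(K)[p] = 0`; port pending] ∧ (Anch) [research = (P3)].

All PROVED (standard axioms); no definition, no named fact, no `sorry`.  Nothing about (Par), (Anch), [NV″], the crux or BSD is asserted.

References: [cite: WZhang2014, Lemma 7.3, Prop. 5.4, Thm. 9.1 (proof, pp. 240–242)] [cite: BertoliniDarmon2005, Thm. 3.2, Lemma 2.6]
[cite: CastellaEtAl2025, §7.4 («by a repeated application of the argument in the proof of [Zha14, Thm. 9.1]»)] [cite: GrossLMS1991, §9]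
[cite: Howard2006Bipartite, Cor. 2.3.5].
-/

-- D-0017: single-problem summit, the namespace repeats the problem name by design.
set_option linter.dupNamespace false
set_option autoImplicit false

noncomputable section

open scoped Classical NumberField

namespace Summit.BirchSwinnertonDyer.BirchSwinnertonDyer.Theorems.SignedBaseChangeAcDivAdmdefSelmerWalk

open WeierstrassCurve NumberField IsDedekindDomain Field Module
  Literature.NumberTheory.EllipticCurves Literature.NumberTheory.GaloisRepresentations Literature.NumberTheory.Automorphic
  Summit.BirchSwinnertonDyer.BirchSwinnertonDyer.Theorems Summit.BirchSwinnertonDyer.BirchSwinnertonDyer.Theorems.AdditiveKoly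
  Summit.BirchSwinnertonDyer.Rank1Residual.X11b.Three.Koly.Method2

variable (W : WeierstrassCurve ℚ) (K : Type) [Field K] [NumberField K] (p : ℕ) [W.IsElliptic] [W.IsGloballyMinimal] [Fact p.Prime]

/-! ## §1 (Cheb) on cell β: Čebotarev with the sign, in the binder shape of the AKR rank-lowering reduction -/

/-- **(Cheb) on cell β** (`p ≥ 5`, `ρ̄_{E,p}` onto, `K` imaginary quadratic, `N_E` Heegner in `K`, `p` SPLIT in `K`, `c ≠ 1`): every non-zero
class of `Sel_n^μ` has non-zero localisation at the place of some NEW Bertolini–Darmon admissible prime `q ∉ n` — the cell-β twin of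
`AdditiveKoly.localCheb_of_admQ_of_dvd` (`p ∣ N_E`): `…AdmdefChebSplit.exists_admissible_loc_ne_zero_of_target` fed with
`…AdmdefChebSplitTarget.exists_admissible_target_of_split` (sign `ν = sgnP μ` of the eigenclass, `conjAct_eq_of_mem_selQP`).
[cite: WZhang2014, Lemma 7.3] [cite: BertoliniDarmon2005, Thm. 3.2] -/
theorem localCheb_of_admQ_of_split (h5 : 5 ≤ p) (hsurj : W.HasSurjectiveModNGaloisRep p) (hK : IsImaginaryQuadratic K)
    (hH : SatisfiesHeegnerHypothesis (W.conductorNorm ℤ) K) (hsp : ((Ideal.span {(p : ℤ)}).primesOver (𝓞 K)).ncard = 2)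
    {c : K ≃ₐ[ℚ] K} (hc1 : c ≠ 1) [Module (ZMod p) (Vp W K p)] :
    ∀ (n : Finset (AdmQ W K p)) (μ : Bool) (x : Vp W K p), x ∈ SelQP W K p c n μ → x ≠ 0 →
      ∃ q : AdmQ W K p, q ∉ n ∧ ∃ v : HeightOneSpectrum (𝓞 K),
        ((q : ℕ) : 𝓞 K) ∈ v.asIdeal ∧ (W.baseChange K).torsionLocMap (v.adicCompletion K) ((p ^ 1 : ℕ) : ℤ) x ≠ 0 := by
  -- adapted from Theorems/AdditiveKolyvaginRoadVisibleCoreBricks.lean `localCheb_of_admQ_of_dvd` (l.215–232)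
  intro n μ x hx hx0
  have hp : p.Prime := Fact.out
  haveI : Fact (Nat.Prime (p ^ 1)) := ⟨by rw [pow_one]; exact hp⟩
  have h5' : 5 ≤ p ^ 1 := by rw [pow_one]; exact h5
  have hsp' : ((Ideal.span {((p ^ 1 : ℕ) : ℤ)}).primesOver (𝓞 K)).ncard = 2 := by rw [pow_one]; exact hsp
  have hsurj' : W.HasSurjectiveModNGaloisRep ((p ^ 1 : ℕ) : ℤ) := by rw [Nat.pow_one]; exact hsurj
  have hν : sgnP μ = 1 ∨ sgnP μ = -1 := by cases μ <;> simp [sgnP]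
  have hxν : conjAct W c ((p ^ 1 : ℕ) : ℤ) x = sgnP μ • x := conjAct_eq_of_mem_selQP W K p c n μ hx
  obtain ⟨q, hqB, hadm, v, hqv, hloc⟩ :=
    SignedBaseChangeAcDivAdmdefChebSplit.exists_admissible_loc_ne_zero_of_target W K (p := p ^ 1) h5' hK hsurj' hc1 hν
      (fun ht hinv ↦ SignedBaseChangeAcDivAdmdefChebSplit.exists_admissible_target_of_split W K (p := p ^ 1) h5' hK hsurj' hsp'
        hH ht hinv hν)
      hx0 hxν (n.image Subtype.val)
  rw [Nat.pow_one] at hadm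
  refine ⟨⟨q, hadm⟩, fun hqn ↦ hqB (Finset.mem_image.mpr ⟨⟨q, hadm⟩, hqn, rfl⟩), v, hqv, fun h0 ↦ hloc h0⟩

/-! ## §2 KERNEL on cell β: rank lowering, descent to a zero vertex, an ODD zero vertex -/

/-- **(A1) RANK LOWERING on cell β** (W. Zhang Prop. 5.4 + Lemma 7.3 for the canonical spaces `Sel_n^μ`): the AKR reduction
`selQP_rankLowering_of_localGlobal` fed with `localCheb_of_admQ_of_split` and the four kernel local inputs `localEquiv_of_admQ`,
`localLine_of_admQ`, `localTrans_of_admQ`, `hiso_of_admQ` (none of which mentions `N_E`) — cell-β twin of `AdditiveKoly.selQP_rankLowering_of_dvd`.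
[cite: WZhang2014, Prop. 5.4, Lemma 7.3, §9 (9.1)–(9.2)] [cite: BertoliniDarmon2005, Lemma 2.6, Thm. 3.2] -/
theorem selQP_rankLowering_of_split (h5 : 5 ≤ p) (hsurj : W.HasSurjectiveModNGaloisRep p) (hK : IsImaginaryQuadratic K)
    (hH : SatisfiesHeegnerHypothesis (W.conductorNorm ℤ) K) (hsp : ((Ideal.span {(p : ℤ)}).primesOver (𝓞 K)).ncard = 2)
    {c : K ≃ₐ[ℚ] K} (hc1 : c ≠ 1) [Module (ZMod p) (Vp W K p)] :
    ∀ (n : Finset (AdmQ W K p)) (μ : Bool) (x : Vp W K p),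
      x ∈ SelQP W K p c n μ → x ≠ 0 →
      ∃ q : AdmQ W K p, q ∉ n ∧ x ∉ SelQP W K p c (insert q n) μ ∧
        SelQP W K p c (insert q n) μ ≤ SelQP W K p c n μ ∧
        finrank (ZMod p) (SelQP W K p c (insert q n) μ) + 1 = finrank (ZMod p) (SelQP W K p c n μ) ∧
        SelQP W K p c (insert q n) (!μ) = SelQP W K p c n (!μ) :=
  selQP_rankLowering_of_localGlobal W K p c ((Fact.out : p.Prime).odd_of_ne_two (by omega))
    (localCheb_of_admQ_of_split W K p h5 hsurj hK hH hsp hc1) (localEquiv_of_admQ W K p hK.1 hc1)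
    (localLine_of_admQ W K p hK.1) (localTrans_of_admQ W K p) (hiso_of_admQ W K p c hK)

/-- **DESCENT TO A ZERO VERTEX on cell β**: above every level `n` there is `n' ⊇ n` with `Sel_{n'}^± = 0` and
`#n' = #n + dim Sel_n⁺ + dim Sel_n⁻` (one new admissible prime per dimension; the proof of `AdditiveKoly.exists_zero_vertex_above` verbatim
with (A1) from `selQP_rankLowering_of_split`; also selwalk sketch §4).  [cite: WZhang2014, Thm. 9.1 (proof)] [cite: CastellaEtAl2025, §7.4]
[cite: Howard2006Bipartite, Cor. 2.3.5] -/
theorem exists_zero_vertex_above_of_split (h5 : 5 ≤ p) (hsurj : W.HasSurjectiveModNGaloisRep p) (hK : IsImaginaryQuadratic K)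
    (hH : SatisfiesHeegnerHypothesis (W.conductorNorm ℤ) K) (hsp : ((Ideal.span {(p : ℤ)}).primesOver (𝓞 K)).ncard = 2)
    {c : K ≃ₐ[ℚ] K} (hc1 : c ≠ 1) [Module (ZMod p) (Vp W K p)] (n : Finset (AdmQ W K p)) :
    ∃ n' : Finset (AdmQ W K p), n ⊆ n' ∧ (∀ μ : Bool, SelQP W K p c n' μ = ⊥) ∧
      n'.card = n.card + (finrank (ZMod p) (SelQP W K p c n true) + finrank (ZMod p) (SelQP W K p c n false)) := by
  -- adapted from Theorems/AdditiveKolyvaginRoadVisibleCoreBricks.lean `exists_zero_vertex_above` (l.254–300)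
  suffices h : ∀ (r : ℕ) (n : Finset (AdmQ W K p)),
      finrank (ZMod p) (SelQP W K p c n true) + finrank (ZMod p) (SelQP W K p c n false) = r →
      ∃ n' : Finset (AdmQ W K p), n ⊆ n' ∧ (∀ μ : Bool, SelQP W K p c n' μ = ⊥) ∧ n'.card = n.card + r from
    h _ n rfl
  intro r
  induction r with
  | zero =>
    intro n hn
    refine ⟨n, subset_rfl, fun μ ↦ ?_, by rw [add_zero]⟩
    haveI := finiteDimensional_selQP W K p c n μ
    have h0 : finrank (ZMod p) (SelQP W K p c n μ) = 0 := by cases μ <;> omega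
    exact Submodule.finrank_eq_zero.mp h0
  | succ r ih =>
    intro n hn
    obtain ⟨μ, hμ⟩ : ∃ μ : Bool, 0 < finrank (ZMod p) (SelQP W K p c n μ) := by
      by_cases h : 0 < finrank (ZMod p) (SelQP W K p c n true)
      · exact ⟨true, h⟩
      · exact ⟨false, by omega⟩
    haveI := finiteDimensional_selQP W K p c n μ
    obtain ⟨x, hx, hx0⟩ : ∃ x ∈ SelQP W K p c n μ, x ≠ 0 := by
      by_contra hall
      push Not at hall
      have : SelQP W K p c n μ = ⊥ := (Submodule.eq_bot_iff _).mpr hall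
      rw [this, finrank_bot] at hμ
      exact lt_irrefl 0 hμ
    obtain ⟨q, hqn, -, -, hfr, heq⟩ := selQP_rankLowering_of_split W K p h5 hsurj hK hH hsp hc1 n μ x hx hx0
    have htot : finrank (ZMod p) (SelQP W K p c (insert q n) true) +
        finrank (ZMod p) (SelQP W K p c (insert q n) false) = r := by
      cases μ
      · have heq' : SelQP W K p c (insert q n) true = SelQP W K p c n true := heq
        rw [heq']
        omega
      · have heq' : SelQP W K p c (insert q n) false = SelQP W K p c n false := heq
        rw [heq']
        omega
    obtain ⟨n', hsub, hzero, hcard⟩ := ih (insert q n) htot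
    refine ⟨n', (Finset.subset_insert q n).trans hsub, hzero, ?_⟩
    rw [hcard, Finset.card_insert_of_notMem hqn]
    omega

/-- **(P2) ON CELL β — AN ODD ZERO VERTEX**: if the bottom dimension `dim Sel⁺ + dim Sel⁻` (level `∅`) is odd, there is an admissible level
`n` of ODD cardinality — exactly `dim Sel⁺ + dim Sel⁻` new admissible primes — with `Sel_n^+ = Sel_n^− = 0` (CHKLL25 §7.4: «by a repeated
application of the argument in the proof of [Zha14, Thm 9.1] … there exists `m = q₁⋯q_r ∈ 𝒩^def` …»; selwalk sketch §4 `exists_oddZeroVertex`).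
[cite: CastellaEtAl2025, §7.4] [cite: WZhang2014, Thm. 9.1 (proof)] -/
theorem exists_oddZeroVertex_of_split (h5 : 5 ≤ p) (hsurj : W.HasSurjectiveModNGaloisRep p) (hK : IsImaginaryQuadratic K)
    (hH : SatisfiesHeegnerHypothesis (W.conductorNorm ℤ) K) (hsp : ((Ideal.span {(p : ℤ)}).primesOver (𝓞 K)).ncard = 2)
    {c : K ≃ₐ[ℚ] K} (hc1 : c ≠ 1) [Module (ZMod p) (Vp W K p)]
    (hodd : Odd (finrank (ZMod p) (SelQP W K p c ∅ true) + finrank (ZMod p) (SelQP W K p c ∅ false))) :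
    ∃ n : Finset (AdmQ W K p), Odd n.card ∧ (∀ μ : Bool, SelQP W K p c n μ = ⊥) ∧
      n.card = finrank (ZMod p) (SelQP W K p c ∅ true) + finrank (ZMod p) (SelQP W K p c ∅ false) := by
  obtain ⟨n, -, hzero, hcard⟩ := exists_zero_vertex_above_of_split W K p h5 hsurj hK hH hsp hc1 ∅
  rw [Finset.card_empty, zero_add] at hcard
  exact ⟨n, hcard ▸ hodd, hzero, hcard⟩

/-! ## §3 [NV″]'s consequent VERBATIM from (Par) + (Anch) on cell β -/

omit [NumberField K] [W.IsElliptic] [Fact p.Prime] in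
/-- A finite set of admissible primes, read in `ℕ`, is a Zhang admissible level (selwalk §5). [cite: WZhang2014, Notations (xiv)] -/
theorem isZhangAdmissibleLevel_image_val (n : Finset (AdmQ W K p)) :
    IsZhangAdmissibleLevel (W.conductorNorm ℤ) K (fun ℓ ↦ W.frobeniusTrace ℓ) p (n.image Subtype.val) := by
  intro q hq
  obtain ⟨q', -, rfl⟩ := Finset.mem_image.mp hq
  exact q'.2

omit [NumberField K] [W.IsElliptic] [Fact p.Prime] in
/-- Reading a level in `ℕ` does not change its cardinality (selwalk §5). [folklore] -/
theorem card_image_val (n : Finset (AdmQ W K p)) : (n.image Subtype.val).card = n.card :=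
  Finset.card_image_of_injective _ Subtype.val_injective

/-- **[NV″]'s consequent on cell β from (Par) + (Anch)** — the conclusion of v6's `DefiniteToricNVTwoMult` ∕ `DefiniteToricNVLeOneMult`
(`Cruxes/AnticyclotomicEisensteinDivisibility/Lines/admdef.lean`) VERBATIM: «∃ `s` Zhang-admissible of odd cardinality, ∃ Brandt set-up `S` of type
`(N, ∏ s)`, Gross point `(ψ, I)`, mod-`p` eigenvector `φ` for `a_•(E)` with `toricPeriod φ ≠ 0`», for `(N : ℤ) = N_E`, on the frame `p ≥ 5`,
`ρ̄_{E,p}` onto, `K` imaginary quadratic, every `ℓ ∣ N` split in `K`, `p` split in `K`, `c ≠ 1`, GIVEN (Par) «`dim Sel_∅⁺ + dim Sel_∅⁻` odd» and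
(Anch) «at every odd admissible level `n` with `Sel_n^± = 0` the Brandt data with non-zero toric period exist at `(N, ∏ n)`».  The walk
(`exists_oddZeroVertex_of_split`, kernel) supplies the odd zero vertex; (Anch) supplies the data there (selwalk §5 `definiteToricNV_of_selwalk`,
with (Cheb) now discharged).  Conditional only on the two displayed hypotheses; nothing is booked.
[cite: CastellaEtAl2025, §7.4] [cite: WZhang2014, Thm. 9.1, Thm. 7.2] [cite: Gross1987, §§3–4] -/
theorem definiteToricNV_of_anchor_of_split {N : ℕ} (hN : (N : ℤ) = W.conductorNorm ℤ) (h5 : 5 ≤ p)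
    (hsurj : W.HasSurjectiveModNGaloisRep p) (hK : IsImaginaryQuadratic K)
    (hHeeg : ∀ ℓ : ℕ, ℓ.Prime → ℓ ∣ N → ((Ideal.span {(ℓ : ℤ)}).primesOver (𝓞 K)).ncard = 2)
    (hsp : ((Ideal.span {(p : ℤ)}).primesOver (𝓞 K)).ncard = 2)
    {c : K ≃ₐ[ℚ] K} (hc1 : c ≠ 1) [Module (ZMod p) (Vp W K p)]
    (hodd : Odd (finrank (ZMod p) (SelQP W K p c ∅ true) + finrank (ZMod p) (SelQP W K p c ∅ false)))
    (hanch : ∀ n : Finset (AdmQ W K p), Odd n.card → (∀ μ : Bool, SelQP W K p c n μ = ⊥) →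
      ∃ (S : Brandt.XiSetup N (∏ q ∈ n.image Subtype.val, q)) (ψ : K →ₐ[ℚ] S.D) (I : Submodule ℤ S.D)
        (φ : Brandt.ClassSet S.O → ZMod p),
        Brandt.IsGrossPoint S.O ψ I ∧
        (letI : Fintype (Brandt.ClassSet S.O) := Fintype.ofFinite _
         φ ∈ Brandt.eigenSpace (ZMod p) (N * ∏ q ∈ n.image Subtype.val, q) (Brandt.matrix S.O) (fun ℓ ↦ W.frobeniusTrace ℓ)) ∧
        Brandt.toricPeriod S.O ψ I φ ≠ 0) :
    ∃ s : Finset ℕ, IsZhangAdmissibleLevel N K (fun ℓ ↦ W.frobeniusTrace ℓ) p s ∧ Odd s.card ∧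
      ∃ (S : Brandt.XiSetup N (∏ q ∈ s, q)) (ψ : K →ₐ[ℚ] S.D) (I : Submodule ℤ S.D)
        (φ : Brandt.ClassSet S.O → ZMod p),
        Brandt.IsGrossPoint S.O ψ I ∧
        (letI : Fintype (Brandt.ClassSet S.O) := Fintype.ofFinite _
         φ ∈ Brandt.eigenSpace (ZMod p) (N * ∏ q ∈ s, q) (Brandt.matrix S.O) (fun ℓ ↦ W.frobeniusTrace ℓ)) ∧
        Brandt.toricPeriod S.O ψ I φ ≠ 0 := by
  have hN' : N = W.conductorNorm ℤ := by exact_mod_cast hN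
  have hH : SatisfiesHeegnerHypothesis (W.conductorNorm ℤ) K := fun ℓ hℓ hℓN ↦ hHeeg ℓ hℓ (hN' ▸ hℓN)
  obtain ⟨n, hodd', hzero, -⟩ := exists_oddZeroVertex_of_split W K p h5 hsurj hK hH hsp hc1 hodd
  obtain ⟨S, ψ, I, φ, hGP, heig, hper⟩ := hanch n hodd' hzero
  refine ⟨n.image Subtype.val, ?_, ?_, S, ψ, I, φ, hGP, heig, hper⟩
  · rw [hN']; exact isZhangAdmissibleLevel_image_val W K p n
  · rw [card_image_val]; exact hodd'

end Summit.BirchSwinnertonDyer.BirchSwinnertonDyer.Theorems.SignedBaseChangeAcDivAdmdefSelmerWalk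

end
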